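import Summits.Ventures.QEC.CircuitDistance.PortK2DataBB144Z
import Summits.Ventures.QEC.CircuitDistance.K2Chunks
import HarnessLib

/-!
# K2(`[[144,12,12]]`) chunk module — COMPUTATIONAL (native_decide; `Lean.ofReduceBool`)

Cell `qec`, CDX, R146/R152 STEP 1 («computational» header; `ofReduceBool` confined to these chunk modules). Checker of record
`K2.K2Data` (qec-cdx-type-1, PortK2Check); data module of record `PortK2DataBB144X/Z` (p669158/9, crit-1 data audit PASS
2026-08-28T21:20Z); chunk glue `K2Chunks` (idea-1 g2). Cube 0, child 13: leaf group 10 of 11.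
Leaf theorems: the K2 DFS accepts below one descendant state of pivot cube 0 (sector Z); sizes are exact DFS visit counts
(eng-1 g2 `k2count.c`), capped so that the gate's native-axiom audit re-verifies every leaf in place. Assemblies re-derive the
child lists in the kernel (`decide`) and end in the literal cube fact `d144Z.cube (Ts144Z.getD 0 []) (0) (lives144Z.getD 0 0) = true`
(the `hcubes` hypothesis of `K2Inst.k2_complete`). Emitted by qec-cdx-eng-1 g2 (`gen2.py`, idea-1's `gen_k2chunks_from_lean.py` lineage).
-/

namespace Summit.Ventures.QEC.CircuitDistance.K2

set_option maxRecDepth 100000 in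
set_option maxHeartbeats 0 in
set_option exponentiation.threshold 1024 in
/-- K2(144) chunk fact `cube144Z0_ch13_16` (639701 DFS visits; see the module docstring). -/
theorem cube144Z0_ch13_16 : app5 (d144Z.dfs (Ts144Z.getD 0 []) 6) (298606704877545473024, 1369, 3978585891278293137674417131848976957518321447771095830301906125905925135797924768251905, 3, 2348542582773833227885502010898055059195229190736216153184089442396740228243455792100630651024502466606530524) = true := by native_decide

set_option maxRecDepth 100000 in
set_option maxHeartbeats 0 in
set_option exponentiation.threshold 1024 in
/-- K2(144) chunk fact `cube144Z0_ch13_17` (791005 DFS visits; see the module docstring). -/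
theorem cube144Z0_ch13_17 : app5 (d144Z.dfs (Ts144Z.getD 0 []) 6) (1181744823696994878720, 961, 31828687130226345098375823028070944003143865892422568006967888831922856968499793798103041, 3, 2348542582773833227853673323767828714097284726854819619417660248745709974327266097579468443215700330572414940) = true := by native_decide

set_option maxRecDepth 100000 in
set_option maxHeartbeats 0 in
set_option exponentiation.threshold 1024 in
/-- K2(144) chunk fact `cube144Z0_ch13_18` (714566 DFS visits; see the module docstring). -/
theorem cube144Z0_ch13_18 : app5 (d144Z.dfs (Ts144Z.getD 0 []) 6) (1188950301625861184, 657, 4074071952668972172537322735965430732339651459573264815363059093019523248686371070130782209, 3, 2348542582773833223779601371098856541560393350036063297314723461413837473054985198870705843689026918205620188) = true := by native_decide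
end Summit.Ventures.QEC.CircuitDistance.K2
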